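import Literature.Topology.FourManifolds.SweepLemma
import HarnessLib

/-!
# The fill lemma: adding a bubble to a compact regular domain along a sweep function

Topic `Literature/Topology/FourManifolds`; twin of `SweepLemma.lean` in the exp-height line of
the fact seat `provefact-Literature.Topology.FourManifolds.SphereEmbedding.schoenflies_exists_ball`
(Alexander's theorem, Schultens (2014), Thm. 3.2.5).  **Everything in this file is proved; no
definitions, no named facts.**

Where the sweep lemma cuts the compact regular domain `A = {F ≤ 0}` down to
`{F ⊔_δ (1 - w) ≤ 0}`, the fill lemma grows it to `{F ⊓_δ (w - 1) ≤ 0}` — `A` together with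
the bubble `{w ≤ 1}`, the concave junction rounded — through the regular family
`A_τ = {F ⊓_δ (w - τ) ≤ 0}`; the smooth minimum is `u ⊓_δ v = u - δ P((u - v)/δ) =
-((-u) ⊔_δ (-v))` for an admissible positive part `P` (`SmoothMax.lean`), and the family is
integrated by `RegularFamily.exists_diffeomorph_image_eq`.

* `SmoothMax.exists_diffeomorph_image_fill` — **the fill lemma**: if `{F ≤ ε₀} ∪
  {w ≤ 1 + ε₀} ⊆ K` compact, `0 < δ < ε₀`, `DF ≠ 0` on the outer collar `{0 ≤ F ≤ 2δ}`,
  `Dw ≠ 0` on `{F ≥ 0} ∩ {w ≤ 1 + 2δ}`, and on the outer collar part of that set `Dw` is never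
  a negative multiple of `DF` (the gradient of `w` never points straight into `A`), then there
  is a diffeomorphism `Φ` of the ambient space with `Φ(A) = {F ⊓_δ (w - 1) ≤ 0}`,
  `Φ(∂A) = {F ⊓_δ (w - 1) = 0}`, `Φ = id` off `K` and on `{w - F ≥ 1 + δ}`.
* `smin_eq_left`, `smin_eq_right`, `smin_le_min`, `min_sub_le_smin` — the smooth minimum off
  the band and its two-sided bounds `min - δ ≤ u ⊓_δ v ≤ min`.

In the application this is the move of Alexander's argument in which the level disc lies
*outside* the ball (Schultens (2014), proof of Thm. 3.2.5, and Lemma 3.2.3): the bubble between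
the level disc and a saddle-free disc of the sphere is filled by the rising levels of the height.

## References

* J. Schultens, *Introduction to 3-Manifolds*, GSM 151 (2014), Lemma 3.2.3 and Thm. 3.2.5
  (PDF pp. 42–45). [Schultens2014]
* J. Milnor, *Morse theory*, Ann. of Math. Studies 51 (1963), Thm. 3.1. [Milnor1963]
-/

open scoped RealInnerProductSpace Topology Manifold ContDiff
open Set Filter Metric Function

noncomputable section

namespace Literature.Topology.FourManifolds

namespace SmoothMax

/-! ### §1 The smooth minimum `u ⊓_δ v = u - δ P((u - v)/δ) = -((-u) ⊔_δ (-v))` -/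

section Values

variable {P : ℝ → ℝ} {δ : ℝ}

/-- Off the band, on the side `u ≤ v - δ`, the smooth minimum is `u`. [folklore] -/
theorem smin_eq_left (hP0 : ∀ s, s ≤ -1 → P s = 0) (hδ : 0 < δ) {u v : ℝ} (h : u ≤ v - δ) :
    u - δ * P ((u - v) / δ) = u := by
  rw [hP0 _ (by rw [div_le_iff₀ hδ]; linarith), mul_zero, sub_zero]

/-- Off the band, on the side `v ≤ u - δ`, the smooth minimum is `v`. [folklore] -/
theorem smin_eq_right (hP1 : ∀ s, 1 ≤ s → P s = s) (hδ : 0 < δ) {u v : ℝ} (h : v ≤ u - δ) :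
    u - δ * P ((u - v) / δ) = v := by
  rw [hP1 _ (by rw [le_div_iff₀ hδ]; linarith), mul_div_cancel₀ _ hδ.ne']
  ring

/-- The smooth minimum is dominated by the minimum. [folklore] -/
theorem smin_le_min (hPge : ∀ s, max 0 s ≤ P s) (hδ : 0 < δ) (u v : ℝ) :
    u - δ * P ((u - v) / δ) ≤ min u v := by
  have h := max_le_smax hPge hδ (-u) (-v)
  rw [show (-v - -u) / δ = (u - v) / δ by ring, max_neg_neg] at h
  linarith

/-- The smooth minimum is at least the minimum minus `δ`. [folklore] -/
theorem min_sub_le_smin (hPle : ∀ s, P s ≤ max 0 s + 1) (hδ : 0 < δ) (u v : ℝ) :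
    min u v - δ ≤ u - δ * P ((u - v) / δ) := by
  have h := smax_le_max_add hPle hδ (-u) (-v)
  rw [show (-v - -u) / δ = (u - v) / δ by ring, max_neg_neg] at h
  linarith

end Values

/-! ### §2 The fill lemma -/

section Fill

variable {E : Type*} [NormedAddCommGroup E] [InnerProductSpace ℝ E] [FiniteDimensional ℝ E]

/-- **The fill lemma.**  Let `A = {F ≤ 0}` be a compact regular domain (`F` smooth,
`{F ≤ ε₀} ⊆ K` compact, `DF ≠ 0` on the outer collar `{0 ≤ F ≤ 2δ}`) and `w` a smooth function
with `{w ≤ 1 + ε₀} ⊆ K` (the bubble `{w ≤ 1}` to be added is bounded), without critical points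
on `{F ≥ 0} ∩ {w ≤ 1 + 2δ}`, and whose derivative on the outer collar part of that set is never
a *negative* multiple of `DF` (the gradient of `w` never points straight into `A`).  Then for
every admissible smooth positive part `P` and `0 < δ < ε₀` the filled and rounded region
`A' = {F ⊓_δ (w - 1) ≤ 0}`, `F ⊓_δ m = F - δ P((F - m)/δ)`, is the image of `A` under a
diffeomorphism `Φ` of `E` carrying `{F = 0}` onto `{F ⊓_δ (w - 1) = 0}`, with `Φ = id` off `K`
and on `{w - F ≥ 1 + δ}`.  Proof: the family `F ⊓_δ (w - τ)`, `τ₀ ≤ τ ≤ 1`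
(`τ₀ ≤ min_K (w - F) - δ`), is a regular family of compact domains and
`RegularFamily.exists_diffeomorph_image_eq` applies.  (Function-theoretic form of the filling
moves in Alexander's theorem — Schultens (2014), proof of Thm. 3.2.5, the case where the level
disc lies outside the ball: the bubble between a level disc and a saddle-free disc of the sphere
is swept by the levels of the height.) [folklore] -/
theorem exists_diffeomorph_image_fill {P : ℝ → ℝ} (hP : ContDiff ℝ ∞ P)
    (hP0 : ∀ s, s ≤ -1 → P s = 0) (hP1 : ∀ s, 1 ≤ s → P s = s)
    (hPd : ∀ s, 0 ≤ deriv P s ∧ deriv P s ≤ 1) (hPge : ∀ s, max 0 s ≤ P s)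
    (hPle : ∀ s, P s ≤ max 0 s + 1)
    {F w : E → ℝ} (hF : ContDiff ℝ ∞ F) (hw : ContDiff ℝ ∞ w) {K : Set E} (hK : IsCompact K)
    {ε₀ : ℝ} (hKF : ∀ x, F x ≤ ε₀ → x ∈ K) (hKw : ∀ x, w x ≤ 1 + ε₀ → x ∈ K)
    {δ : ℝ} (hδ : 0 < δ) (hδε : δ < ε₀)
    (H1 : ∀ x, 0 ≤ F x → F x ≤ 2 * δ → fderiv ℝ F x ≠ 0)
    (H2 : ∀ x, 0 ≤ F x → w x ≤ 1 + 2 * δ → fderiv ℝ w x ≠ 0)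
    (H3 : ∀ x, 0 ≤ F x → F x ≤ 2 * δ → w x ≤ 1 + 2 * δ → ∀ c : ℝ, c < 0 →
      fderiv ℝ w x ≠ c • fderiv ℝ F x) :
    ∃ Φ : E ≃ₘ⟮𝓘(ℝ, E), 𝓘(ℝ, E)⟯ E,
      Φ '' {x | F x ≤ 0} = {x | F x - δ * P ((F x - (w x - 1)) / δ) ≤ 0} ∧
      Φ '' {x | F x = 0} = {x | F x - δ * P ((F x - (w x - 1)) / δ) = 0} ∧
      (∀ x, 1 + δ ≤ w x - F x → Φ x = x) ∧ (∀ x, x ∉ K → Φ x = x) := by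
  have hPdiff : Differentiable ℝ P := hP.differentiable (by simp)
  -- the starting time `τ₀ ≤ min_K (w - F) - δ`, `τ₀ ≤ 1`
  obtain ⟨τ₀, hτ₀1, hτ₀K⟩ : ∃ τ₀ : ℝ, τ₀ ≤ 1 ∧ ∀ x ∈ K, τ₀ ≤ w x - F x - δ := by
    by_cases hne : K.Nonempty
    · obtain ⟨x₀, hx₀, hmin⟩ :=
        hK.exists_isMinOn hne ((hw.continuous.sub hF.continuous).continuousOn)
      exact ⟨min 1 (w x₀ - F x₀ - δ), min_le_left _ _, fun x hx =>
        (min_le_right _ _).trans (by have h' : w x₀ - F x₀ ≤ w x - F x := hmin hx; linarith)⟩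
    · exact ⟨1, le_rfl, fun x hx => (hne ⟨x, hx⟩).elim⟩
  -- the family
  set T : ℝ → ℝ := fun σ => τ₀ + σ * (1 - τ₀) with hT
  have hT0 : T 0 = τ₀ := by simp [hT]
  have hT1 : T 1 = 1 := by simp [hT]
  have hTle : ∀ σ ∈ Icc (0 : ℝ) 1, T σ ≤ 1 := fun σ hσ => by
    simp only [hT]; nlinarith [hσ.1, hσ.2]
  have hTge : ∀ σ ∈ Icc (0 : ℝ) 1, τ₀ ≤ T σ := fun σ hσ => by
    simp only [hT]; nlinarith [hσ.1, hσ.2]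
  set G : ℝ × E → ℝ := fun p => F p.2 - δ * P ((F p.2 - (w p.2 - T p.1)) / δ) with hG
  have hTs : ContDiff ℝ ∞ T := (contDiff_const.add (contDiff_id.mul contDiff_const))
  have hGs : ContDiff ℝ ∞ G := by
    refine (hF.comp contDiff_snd).sub (contDiff_const.mul (hP.comp ?_))
    exact ((hF.comp contDiff_snd).sub ((hw.comp contDiff_snd).sub (hTs.comp contDiff_fst))).div_const δ
  -- `min - δ ≤ G ≤ min`
  have hGle : ∀ p : ℝ × E, G p ≤ min (F p.2) (w p.2 - T p.1) := fun p =>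
    smin_le_min hPge hδ (F p.2) (w p.2 - T p.1)
  have hGge : ∀ p : ℝ × E, min (F p.2) (w p.2 - T p.1) - δ ≤ G p := fun p =>
    min_sub_le_smin hPle hδ (F p.2) (w p.2 - T p.1)
  -- hypotheses of the isotopy lemma
  have hε₀' : 0 < ε₀ - δ := by linarith
  have hKG : ∀ σ ∈ Icc (0 : ℝ) 1, ∀ x, |G (σ, x)| ≤ ε₀ - δ → x ∈ K := by
    intro σ hσ x hx
    have h1 : min (F x) (w x - T σ) - δ ≤ ε₀ - δ :=
      (hGge (σ, x)).trans ((le_abs_self _).trans hx)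
    rcases le_total (F x) (w x - T σ) with h | h
    · rw [min_eq_left h] at h1
      exact hKF x (by linarith)
    · rw [min_eq_right h] at h1
      exact hKw x (by linarith [hTle σ hσ])
  have hreg : ∀ σ ∈ Icc (0 : ℝ) 1, ∀ x, G (σ, x) = 0 → fderiv ℝ (fun y => G (σ, y)) x ≠ 0 := by
    intro σ hσ x hx0
    set τ := T σ with hτ
    set s : ℝ := (F x - (w x - τ)) / δ with hs
    -- `G_σ = -((-F) ⊔_δ (-(w - τ)))`: derivative `(1 - θ) DF + θ Dw`
    have hderiv : HasFDerivAt (fun y => G (σ, y))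
        ((1 - deriv P s) • fderiv ℝ F x + deriv P s • fderiv ℝ w x) x := by
      have h := hasFDerivAt_smax (P := P) (δ := δ) hPdiff hδ.ne' (F := fun y => -F y)
        (ℓ := fun y => -(w y - τ))
        ((hF.differentiable (by simp) x).hasFDerivAt.neg)
        (((hw.differentiable (by simp) x).hasFDerivAt.sub_const τ).neg)
      have h' := h.neg.congr_of_eventuallyEq (f₁ := fun y => G (σ, y))
        (Eventually.of_forall fun y => by
          show G (σ, y) = -(-F y + δ * P ((-(w y - τ) - -F y) / δ))
          simp only [hG]
          rw [show (-(w y - τ) - -F y) / δ = (F y - (w y - T σ)) / δ by rw [hτ]; ring]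
          ring)
      refine h'.congr_fderiv ?_
      rw [show (-(w x - τ) - -F x) / δ = s by rw [hs]; ring]
      ext v
      simp [smul_neg]
      ring
    rw [hderiv.fderiv]
    have hG0 : F x - δ * P s = 0 := by simpa [hG, hs] using hx0
    -- case analysis on the position in the band
    rcases le_or_gt s (-1) with hs1 | hs1
    · -- `G = F` near `x`
      rw [deriv_eq_zero_of_le hP0 hPge hs1]
      simp only [sub_zero, one_smul, zero_smul, add_zero]
      have hFx : F x = 0 := by rw [hP0 s hs1, mul_zero, sub_zero] at hG0; exact hG0
      exact H1 x hFx.ge (by linarith)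
    rcases le_or_gt 1 s with hs2 | hs2
    · -- `G = w - τ` near `x`
      rw [deriv_eq_one_of_le hPdiff hP1 hPge hs2]
      simp only [sub_self, zero_smul, one_smul, zero_add]
      have hm : w x - τ = 0 := by
        rw [hP1 s hs2, hs, mul_div_cancel₀ _ hδ.ne'] at hG0; linarith
      have hFge : 0 ≤ F x := by
        have : 1 ≤ (F x - (w x - τ)) / δ := hs2
        rw [le_div_iff₀ hδ] at this; linarith
      exact H2 x hFge (by linarith [hTle σ hσ])
    · -- in the band: `F` and `w - τ` lie in `[0, 2δ)`
      have hlo : -δ < F x - (w x - τ) := by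
        have : -1 < (F x - (w x - τ)) / δ := hs1
        rw [lt_div_iff₀ hδ] at this; linarith
      have hhi : F x - (w x - τ) < δ := by
        have : (F x - (w x - τ)) / δ < 1 := hs2
        rw [div_lt_iff₀ hδ] at this; linarith
      have hmin0 : 0 ≤ min (F x) (w x - τ) := by
        have := hGle (σ, x)
        rw [hx0] at this
        exact this
      have hmin1 : min (F x) (w x - τ) ≤ δ := by
        have := hGge (σ, x)
        rw [hx0] at this
        have h2 : min (F x) (w x - T σ) - δ ≤ 0 := this
        simp only [hτ]
        linarith
      have hF0 : 0 ≤ F x := le_trans hmin0 (min_le_left _ _)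
      have hm0 : 0 ≤ w x - τ := le_trans hmin0 (min_le_right _ _)
      have hF2 : F x ≤ 2 * δ := by
        rcases le_total (F x) (w x - τ) with h | h
        · rw [min_eq_left h] at hmin1; linarith
        · rw [min_eq_right h] at hmin1; linarith
      have hw2 : w x ≤ 1 + 2 * δ := by
        rcases le_total (F x) (w x - τ) with h | h
        · rw [min_eq_left h] at hmin1; linarith [hTle σ hσ]
        · rw [min_eq_right h] at hmin1; linarith [hTle σ hσ]
      obtain ⟨hθ0, hθ1⟩ := hPd s
      set θ := deriv P s with hθ
      intro hzero
      rcases hθ0.eq_or_lt with h0 | h0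
      · rw [← h0] at hzero
        simp only [sub_zero, one_smul, zero_smul, add_zero] at hzero
        exact H1 x hF0 hF2 hzero
      rcases hθ1.eq_or_lt' with h1 | h1
      · rw [← h1] at hzero
        simp only [sub_self, zero_smul, one_smul, zero_add] at hzero
        exact H2 x hF0 hw2 hzero
      · -- 0 < θ < 1: `Dw` is a negative multiple of `DF`
        have hc : fderiv ℝ w x = (-((1 - θ) / θ)) • fderiv ℝ F x := by
          have h' : θ • fderiv ℝ w x = -((1 - θ) • fderiv ℝ F x) :=
            eq_neg_of_add_eq_zero_right hzero
          calc fderiv ℝ w x = θ⁻¹ • (θ • fderiv ℝ w x) := by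
                rw [smul_smul, inv_mul_cancel₀ h0.ne', one_smul]
            _ = θ⁻¹ • (-((1 - θ) • fderiv ℝ F x)) := by rw [h']
            _ = (-((1 - θ) / θ)) • fderiv ℝ F x := by
                rw [smul_neg, smul_smul, ← neg_smul, div_eq_inv_mul]
        exact H3 x hF0 hF2 hw2 (-((1 - θ) / θ)) (by
          have : 0 < (1 - θ) / θ := div_pos (by linarith) h0
          linarith) hc
  -- the isotopy lemma
  obtain ⟨Φ, hle, heq, -, hfix, hKfix⟩ :=
    RegularFamily.exists_diffeomorph_image_eq hGs hK hε₀' hKG hreg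
  -- the initial member defines `A` exactly: `G (0, ·) = F` on `K`, and both are `> 0` off `K`
  have hG0K : ∀ x ∈ K, G (0, x) = F x := by
    intro x hx
    simp only [hG, hT0]
    exact smin_eq_left hP0 hδ (by linarith [hτ₀K x hx])
  have hG0pos : ∀ x, x ∉ K → 0 < G (0, x) ∧ 0 < F x := by
    intro x hx
    have hF' : ε₀ < F x := lt_of_not_ge fun h' => hx (hKF x h')
    have hw' : 1 + ε₀ < w x := lt_of_not_ge fun h' => hx (hKw x h')
    refine ⟨lt_of_lt_of_le ?_ (hGge (0, x)), by linarith⟩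
    simp only [hT0]
    rcases le_total (F x) (w x - τ₀) with h | h
    · rw [min_eq_left h]; linarith
    · rw [min_eq_right h]; linarith
  have hset0 : {x | G (0, x) ≤ 0} = {x | F x ≤ 0} := by
    ext x
    simp only [mem_setOf_eq]
    by_cases hx : x ∈ K
    · rw [hG0K x hx]
    · constructor
      · intro h; linarith [(hG0pos x hx).1]
      · intro h; linarith [(hG0pos x hx).2]
  have hset0' : {x | G (0, x) = 0} = {x | F x = 0} := by
    ext x
    simp only [mem_setOf_eq]
    by_cases hx : x ∈ K
    · rw [hG0K x hx]
    · constructor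
      · intro h; linarith [(hG0pos x hx).1]
      · intro h; linarith [(hG0pos x hx).2]
  have hset1 : ∀ x, G (1, x) = F x - δ * P ((F x - (w x - 1)) / δ) := fun x => by
    simp only [hG, hT1]
  -- the time derivative vanishes where `w - F ≥ 1 + δ`
  have hstat : ∀ x, 1 + δ ≤ w x - F x → ∀ σ ∈ Icc (0 : ℝ) 1, fderiv ℝ G (σ, x) (1, 0) = 0 := by
    intro x hx σ hσ
    have hGd : DifferentiableAt ℝ G (σ, x) := hGs.differentiable (by simp) _
    have hc1 : HasDerivAt (fun σ' : ℝ => ((σ', x) : ℝ × E)) ((1 : ℝ), (0 : E)) σ :=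
      (hasDerivAt_id σ).prodMk (hasDerivAt_const σ x)
    have h1 : HasDerivAt (G ∘ fun σ' : ℝ => ((σ', x) : ℝ × E)) (fderiv ℝ G (σ, x) ((1 : ℝ), (0 : E))) σ :=
      hGd.hasFDerivAt.comp_hasDerivAt σ hc1
    set s : ℝ := (F x - (w x - T σ)) / δ with hs
    have hs1 : s ≤ -1 := by
      rw [hs, div_le_iff₀ hδ]; linarith [hTle σ hσ]
    have hTd : HasDerivAt T (1 - τ₀) σ := by
      have := ((hasDerivAt_id σ).mul_const (1 - τ₀)).const_add τ₀
      simpa [hT] using this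
    have hinner : HasDerivAt (fun σ' => (F x - (w x - T σ')) / δ) ((1 - τ₀) / δ) σ := by
      have := ((hTd.const_sub (w x)).const_sub (F x)).div_const δ
      simpa using this
    have hP' : HasDerivAt P (deriv P s) s := (hPdiff s).hasDerivAt
    have h2 : HasDerivAt (fun σ' => F x - δ * P ((F x - (w x - T σ')) / δ))
        (0 - δ * (deriv P s * ((1 - τ₀) / δ))) σ :=
      (hasDerivAt_const σ (F x)).sub ((hP'.comp σ hinner).const_mul δ)
    have h12 : (G ∘ fun σ' : ℝ => ((σ', x) : ℝ × E)) =
        fun σ' => F x - δ * P ((F x - (w x - T σ')) / δ) := by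
      funext σ'; simp [hG]
    rw [h12] at h1
    rw [h1.unique h2, deriv_eq_zero_of_le hP0 hPge hs1]
    simp
  refine ⟨Φ, ?_, ?_, fun x hx => hfix x (hstat x hx), hKfix⟩
  · rw [← hset0, hle]
    ext x; simp only [mem_setOf_eq, hset1]
  · rw [← hset0', heq]
    ext x; simp only [mem_setOf_eq, hset1]

end Fill

end SmoothMax

end Literature.Topology.FourManifolds

end
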